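import Literature.NumberTheory.EllipticCurves.PAdicLFunctionIntegralityAtTwoProofs
import HarnessLib

/-!
# `L₂(f, α, T) ∈ ℤ₂⟦T⟧` for EVERY rational newform of odd level ordinary at `2` — no hypothesis
# on `E[2]` ("INT2-AUTO"; proofs only)

A *proofs* file (theorems only: no definition, no named fact; D-0014/D-0026), strengthening
`PAdicLFunctionIntegralityAtTwoProofs.padicLFunction_integral_two`, which proved the `2`-integrality
of the tree's `2`-adic `L`-function `padicLFunction f α` (Mazur–Tate–Teitelbaum measure built on
`[x]⁺_f = re {∞,x}_f / Ω⁺_f`, `Ω⁺_f = plusPeriod f` with `re Λ_f = ℤ · Ω⁺_f/2`; `Δ = {±1}`-pushforward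
included, `γ = 5`) under the hypothesis "`E[2]` irreducible" (an odd Eisenstein multiple of
`{∞, 0}_f`). That hypothesis is SUPERFLUOUS: the Hecke operator `T₂` itself supplies the Eisenstein
multiple at `2`.

THE ARGUMENT (o1 lens-1 GEN 4, G4.1 "INT2-AUTO", `HOME/cells/o1/ROUTES-O1.md` l.1150; Manin's
trick + one Hecke relation, Cremona 1997 §2.8–2.9, Mazur–Tate–Teitelbaum 1986 §I.4 (4.2), §I.10):
1. (`exists_normalizedPlusSymbol_sub_zero_eq_div_two`) for `f` with real coefficients and a cusp `x`
   with `gcd(den x, N) = 1`: `{∞, x} ≡ {∞, 0} (mod Λ_f)` (Manin), so `[x]⁺ − [0]⁺ = k/2`, `k ∈ ℤ`;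
2. (`normalizedPlusSymbol_half_eq`) the Hecke relation `a₂{∞,0} = {∞,0} + {∞,1/2} + {∞,0}` at the
   cusp `0` (`intCast_mul_normalizedPlusSymbol`, `2 ∤ N`): `[1/2]⁺ = (a₂ − 2)[0]⁺`, whence with 1.
   at `x = 1/2`: **`(a₂ − 3)[0]⁺ ∈ ½ℤ`** (`exists_sub_three_mul_normalizedPlusSymbol_zero_eq_div_two`);
3. (`norm_sub_one_mul_ratPlusSymbol_zero_le_two`) for a root `α` of `X² − a₂X + 2` with `‖α⁻¹‖ ≤ 1`
   (the unit root): `(α − 1)(α − 2) = (a₂ − 3)α` and `‖α − 2‖₂ = 1`, so `‖(α − 1)[0]⁺‖₂ ≤ 2`;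
4. (`norm_msdMeasure_two_le_two_auto`) hence `μ_{f,α}(a + 2^{m+1}ℤ₂) = α^{−(m+1)}k₁/2 − α^{−(m+2)}k₂/2
   + α^{−(m+2)}(α − 1)[0]⁺` has norm `≤ 2`, and so has `μ(ℤ₂) = (1 − α⁻¹)[0]⁺`;
5. (`norm_padicLCoeff_two_le_one_auto`, **`padicLFunction_integral_two_auto`**,
   `exists_iwasawaToPowerSeries_eq_padicLFunction_two_auto`) by the `Δ = {±1}`-doubling
   (`padicLRiemannSum_two`) every Riemann sum has norm `≤ ‖2‖₂ · 2 = 1`, the sums converge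
   (`tendsto_padicLRiemannSum_of_norm_le`, distribution relation `msdMeasure_distribution_of_isNewformOf`),
   so every coefficient of `L₂(f, α, T)` lies in `ℤ₂`: `∃ L₀ : IwasawaAlgebra 2, ι L₀ = padicLFunction f α`.
The rationality of `[0]⁺` is not assumed: if `[0]⁺ ∉ ℚ` then every `[x]⁺` (`x ∼ 0`) is irrational,
`ratPlusSymbol f x = 0` (junk branch) and all bounds hold trivially (`exists_ratPlusSymbol_eq_add_div_two`).

CAVEAT (normalisation, o1 lens-1 G4.8 / refuter MTT page-check pending): the statement is about the
tree's `padicLFunction f α`, whose Riemann sums run over BOTH elements of `Δ = {±1}` (the doubling of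
`padicLRiemannSum_two`); if Mazur–Tate–Teitelbaum's own `2`-adic measure is read as HALF of it, the
printed-normalisation statement is "coefficients in `½ℤ₂`, and in `ℤ₂` iff `v₂(ε_f) ≥ 1`",
`ε_f = 2(1 − α⁻¹)[0]⁺`. Nothing here decides that reading; the theorem below is exact for the tree's
object. It is also a statement about `f` and `Ω⁺_f` — the passage to a curve `W` in the isogeny class
(`Ω_W` vs `Ω⁺_f`: Manin constant, lattice index) is the cell's A-PER2 bookkeeping, not touched here.

STATUS IN PRINT: elementary and presumably folklore (the Manin-trick half of Stevens' integrality
discussion, Stevens 1989 §4; Greenberg–Vatsal 2000 Prop. 3.7 for odd `p`); no printed statement at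
`p = 2` in this normalisation was found (lens-1 presearch, ROUTES-O1 l.1150). EVIDENCE before this
proof (census, not used): `v₂(ε_f) ≥ 0` on all 618 good-ordinary optimal `f` with `N ≤ 500` of the
o1 census, minimum `0` attained on 6 (TWIST-MT2-final-v2, col `v2_eps`).

## References

* B. Mazur, J. Tate, J. Teitelbaum, *On `p`-adic analogues of the conjectures of Birch and
  Swinnerton-Dyer*, Invent. Math. 84 (1986), §I.4 (4.2), §I.8, §I.10 (10.1), §I.13.
  [MazurTateTeitelbaum1986Invent]
* J. E. Cremona, *Algorithms for modular elliptic curves*, 2nd ed. (1997), §2.2, §2.8–2.9.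
  [CremonaAlgorithms1997]
* G. Stevens, *Stickelberger elements and modular parametrizations of elliptic curves*, Invent.
  Math. 98 (1989), 75–106, §4 (mechanism, odd `p`). [Stevens1989]
-/

noncomputable section

open Filter Topology

open scoped MatrixGroups

open CongruenceSubgroup Literature.NumberTheory.EllipticCurves.ModularForms

namespace Literature.NumberTheory.EllipticCurves.ModularForms

/-! ### §1. `[x]⁺ − [0]⁺ ∈ ½ℤ` and the Hecke relation at the cusp `0` -/

section Symbols

variable {N : ℕ} [NeZero N] (f : CuspForm (Gamma0 N) 2)

/-- **`[x]⁺_f − [0]⁺_f ∈ ½ℤ` at a cusp with denominator prime to `N`** (real coefficients):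
`{∞, x} − {∞, 0} ∈ Λ_f` (`modularSymbol_sub_zero_mem_periodLattice`, Manin), `re Λ_f = ℤ · Ω⁺_f/2`,
and `[x]⁺ = re{∞,x}/Ω⁺_f` (`plusSymbol_eq_re_holds`); junk case `Ω⁺_f = 0`: both symbols vanish.
[cite: CremonaAlgorithms1997, §2.8] [cite: Manin1972, Prop. 1.4 and Thm. 1.6] -/
theorem exists_normalizedPlusSymbol_sub_zero_eq_div_two (hreal : ∀ n, (cuspCoeff f n).im = 0)
    {x : ℚ} (hx : Nat.Coprime x.den N) :
    ∃ k : ℤ, normalizedPlusSymbol f x - normalizedPlusSymbol f 0 = (k : ℝ) / 2 := by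
  by_cases hΩ : plusPeriod f = 0
  · refine ⟨0, ?_⟩
    rw [normalizedPlusSymbol_eq_zero_of_plusPeriod_eq_zero f hΩ,
      normalizedPlusSymbol_eq_zero_of_plusPeriod_eq_zero f hΩ]
    simp
  obtain ⟨hre, hpos⟩ := realPeriods_eq_zmultiples_of_plusPeriod_ne_zero f hΩ
  obtain ⟨k, hk⟩ := exists_re_eq_add_of_sub_mem f hre (modularSymbol_sub_zero_mem_periodLattice f hx)
  refine ⟨k, ?_⟩
  rw [normalizedPlusSymbol, normalizedPlusSymbol, plusSymbol_eq_re_holds f hreal x,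
    plusSymbol_eq_re_holds f hreal 0, Complex.ofReal_re, Complex.ofReal_re, hk]
  field_simp
  ring

/-- **The Hecke relation at the cusp `0` for `p = 2 ∤ N`**: `a₂{∞,0} = {∞,0/2} + {∞,1/2} + {∞,2·0}`
(`intCast_mul_normalizedPlusSymbol`, Mazur–Tate–Teitelbaum (4.2)), i.e. `[1/2]⁺ = (a₂ − 2)[0]⁺`.
[cite: MazurTateTeitelbaum1986Invent, §I.4 (4.2)] -/
theorem normalizedPlusSymbol_half_eq {f : CuspForm (Gamma0 N) 2} (hf : IsNewform0 f) (h2N : ¬ 2 ∣ N)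
    {a₂ : ℤ} (ha₂ : cuspCoeff f 2 = a₂) :
    normalizedPlusSymbol f (1 / 2) = ((a₂ : ℝ) - 2) * normalizedPlusSymbol f 0 := by
  have h := intCast_mul_normalizedPlusSymbol 2 hf Nat.prime_two h2N ha₂ 0
  rw [Fin.sum_univ_two] at h
  simp only [Fin.val_zero, Fin.val_one, Nat.cast_zero, Nat.cast_one, zero_add, zero_div,
    mul_zero, Nat.cast_ofNat] at h
  linarith

/-- **`(a₂ − 3)[0]⁺_f ∈ ½ℤ` for a newform of ODD level with real coefficients**: `[1/2]⁺ − [0]⁺ ∈ ½ℤ`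
(the cusp `1/2` has denominator `2`, prime to `N`) and `[1/2]⁺ = (a₂ − 2)[0]⁺`. This is the
Eisenstein multiple at `2` ("`T₂ − 3 = T₂ − 2 − 1`"), available WITHOUT any hypothesis on `E[2]`.
[cite: MazurTateTeitelbaum1986Invent, §I.4 (4.2)] [cite: CremonaAlgorithms1997, §2.8] -/
theorem exists_sub_three_mul_normalizedPlusSymbol_zero_eq_div_two {f : CuspForm (Gamma0 N) 2}
    (hf : IsNewform0 f) (hreal : ∀ n, (cuspCoeff f n).im = 0) (h2N : ¬ 2 ∣ N) {a₂ : ℤ}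
    (ha₂ : cuspCoeff f 2 = a₂) :
    ∃ k : ℤ, ((a₂ : ℝ) - 3) * normalizedPlusSymbol f 0 = (k : ℝ) / 2 := by
  have hx : Nat.Coprime (1 / 2 : ℚ).den N := by
    have h := coprime_den_div_prime_pow (p := 2) h2N 1 1
    rwa [Nat.cast_one, pow_one, Nat.cast_ofNat] at h
  obtain ⟨k, hk⟩ := exists_normalizedPlusSymbol_sub_zero_eq_div_two f hreal hx
  refine ⟨k, ?_⟩
  rw [normalizedPlusSymbol_half_eq hf h2N ha₂] at hk
  linarith

end Symbols

end Literature.NumberTheory.EllipticCurves.ModularForms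

namespace Literature.NumberTheory.EllipticCurves

/-! ### §2. The rational plus symbols: `[x]⁺ = [0]⁺ + k/2` and `(a₂ − 3)[0]⁺ = k/2` in `ℚ` -/

section RatSymbols

variable {N : ℕ} [NeZero N] (f : CuspForm (Gamma0 N) 2)

/-- **`ratPlusSymbol f x = ratPlusSymbol f 0 + k/2`, `k ∈ ℤ`, at a cusp with denominator prime to
`N`** (real coefficients): `[x]⁺ − [0]⁺ ∈ ½ℤ` as real numbers
(`exists_normalizedPlusSymbol_sub_zero_eq_div_two`); when `[0]⁺ ∈ ℚ` both `dite`s defining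
`ratPlusSymbol` fire, and when `[0]⁺ ∉ ℚ` then `[x]⁺ ∉ ℚ` either and both sides are the junk value
`0` (`k = 0`). No Manin–Drinfeld input. [cite: MazurTateTeitelbaum1986Invent, §I.8] -/
theorem exists_ratPlusSymbol_eq_add_div_two (hreal : ∀ n, (cuspCoeff f n).im = 0) {x : ℚ}
    (hx : Nat.Coprime x.den N) :
    ∃ k : ℤ, ratPlusSymbol f x = ratPlusSymbol f 0 + (k : ℚ) / 2 := by
  classical
  obtain ⟨k, hk⟩ := exists_normalizedPlusSymbol_sub_zero_eq_div_two f hreal hx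
  by_cases h0 : ∃ q : ℚ, (q : ℝ) = normalizedPlusSymbol f 0
  · have hx' : ∃ q : ℚ, (q : ℝ) = normalizedPlusSymbol f x := by
      obtain ⟨q, hq⟩ := h0
      exact ⟨q + (k : ℚ) / 2, by push_cast; rw [hq]; linarith⟩
    refine ⟨k, ?_⟩
    unfold ratPlusSymbol
    rw [dif_pos hx', dif_pos h0]
    apply Rat.cast_injective (α := ℝ)
    push_cast
    rw [hx'.choose_spec, h0.choose_spec]
    linarith
  · have hx' : ¬ ∃ q : ℚ, (q : ℝ) = normalizedPlusSymbol f x := by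
      rintro ⟨q, hq⟩
      exact h0 ⟨q - (k : ℚ) / 2, by push_cast; rw [hq]; linarith⟩
    refine ⟨0, ?_⟩
    unfold ratPlusSymbol
    rw [dif_neg hx', dif_neg h0]
    simp

/-- **`(a₂ − 3) · ratPlusSymbol f 0 = k/2`, `k ∈ ℤ`**, for a newform of odd level with real
coefficients (`[0]⁺ ∉ ℚ` gives the junk `0 = 0/2`). [cite: MazurTateTeitelbaum1986Invent, §I.4 (4.2)] -/
theorem exists_sub_three_mul_ratPlusSymbol_zero_eq_div_two {f : CuspForm (Gamma0 N) 2}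
    (hf : IsNewform0 f) (hreal : ∀ n, (cuspCoeff f n).im = 0) (h2N : ¬ 2 ∣ N) {a₂ : ℤ}
    (ha₂ : cuspCoeff f 2 = a₂) :
    ∃ k : ℤ, ((a₂ : ℚ) - 3) * ratPlusSymbol f 0 = (k : ℚ) / 2 := by
  classical
  by_cases h0 : ∃ q : ℚ, (q : ℝ) = normalizedPlusSymbol f 0
  · obtain ⟨k, hk⟩ := exists_sub_three_mul_normalizedPlusSymbol_zero_eq_div_two hf hreal h2N ha₂
    refine ⟨k, ?_⟩
    unfold ratPlusSymbol
    rw [dif_pos h0]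
    apply Rat.cast_injective (α := ℝ)
    push_cast
    rw [h0.choose_spec, hk]
  · refine ⟨0, ?_⟩
    unfold ratPlusSymbol
    rw [dif_neg h0]
    simp

end RatSymbols

/-! ### §3. `2`-adic norms: `‖(α − 1)[0]⁺‖₂ ≤ 2` and `‖μ_{f,α}‖₂ ≤ 2` -/

section Measure

variable {N : ℕ} [NeZero N] (f : CuspForm (Gamma0 N) 2)

/-- `‖2‖₂ = 1/2` (restated in the form used below). [folklore] -/
private theorem norm_two_two : ‖(2 : ℚ_[2])‖ = (2 : ℝ)⁻¹ := by
  have h := Padic.norm_p (p := 2)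
  simpa using h

/-- `‖k/2‖₂ ≤ 2` for `k ∈ ℤ`. [folklore] -/
private theorem norm_intCast_div_two_le (k : ℤ) : ‖((k : ℚ_[2])) / 2‖ ≤ 2 := by
  rw [norm_div, norm_two_two, div_inv_eq_mul]
  calc ‖(k : ℚ_[2])‖ * 2 ≤ 1 * 2 := by gcongr; exact Padic.norm_int_le_one k
    _ = 2 := one_mul _

/-- **`‖(α − 1)·[0]⁺_f‖₂ ≤ 2`** for a newform of odd level with real coefficients and a root `α` of
`X² − a₂X + 2` with `‖α⁻¹‖₂ ≤ 1`: `(α − 1)(α − 2) = α² − 3α + 2 = (a₂ − 3)α`, `‖α‖₂ = 1 = ‖α − 2‖₂`,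
and `‖(a₂ − 3)[0]⁺‖₂ = ‖k/2‖₂ ≤ 2`. [cite: MazurTateTeitelbaum1986Invent, §I.10 (10.1)] -/
theorem norm_sub_one_mul_ratPlusSymbol_zero_le_two {f : CuspForm (Gamma0 N) 2} (hf : IsNewform0 f)
    (hreal : ∀ n, (cuspCoeff f n).im = 0) (h2N : ¬ 2 ∣ N) {a₂ : ℤ} (ha₂ : cuspCoeff f 2 = a₂)
    {α : ℚ_[2]} (hα : ‖α⁻¹‖ ≤ 1) (hroot : α ^ 2 - a₂ * α + 2 = 0) :
    ‖(α - 1) * ((ratPlusSymbol f 0 : ℚ) : ℚ_[2])‖ ≤ 2 := by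
  obtain ⟨k, hk⟩ := exists_sub_three_mul_ratPlusSymbol_zero_eq_div_two hf hreal h2N ha₂
  set q : ℚ_[2] := ((ratPlusSymbol f 0 : ℚ) : ℚ_[2]) with hq
  have hα0 : α ≠ 0 := by rintro rfl; norm_num at hroot
  -- `‖α‖ = 1`
  have hαle : ‖α‖ ≤ 1 := by
    have h1 : α = (a₂ : ℚ_[2]) - 2 * α⁻¹ := by
      field_simp
      linear_combination hroot
    rw [h1, sub_eq_add_neg]
    refine (Padic.nonarchimedean _ _).trans (max_le (Padic.norm_int_le_one _) ?_)
    rw [norm_neg, norm_mul, norm_two_two]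
    calc (2 : ℝ)⁻¹ * ‖α⁻¹‖ ≤ 2⁻¹ * 1 := by gcongr
      _ ≤ 1 := by norm_num
  have hαge : 1 ≤ ‖α‖ := by
    have h := norm_mul α α⁻¹
    rw [mul_inv_cancel₀ hα0, norm_one] at h
    nlinarith [norm_nonneg α, norm_nonneg α⁻¹]
  have hαu : ‖α‖ = 1 := le_antisymm hαle hαge
  -- `‖α - 2‖ = 1`
  have hα2 : ‖α - 2‖ = 1 := by
    refine le_antisymm ?_ ?_
    · rw [sub_eq_add_neg]
      refine (Padic.nonarchimedean _ _).trans (max_le hαle ?_)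
      rw [norm_neg, norm_two_two]; norm_num
    · have h : ‖α‖ ≤ max ‖α - 2‖ ‖(2 : ℚ_[2])‖ := by
        have := Padic.nonarchimedean (α - 2) 2
        rwa [sub_add_cancel] at this
      rw [hαu, norm_two_two] at h
      rcases le_max_iff.mp h with h | h
      · exact h
      · norm_num at h
  -- `(α - 1) q (α - 2) = (a₂ - 3) q α`
  have hkey : (α - 1) * q * (α - 2) = (((a₂ : ℚ) - 3) * ratPlusSymbol f 0 : ℚ) * α := by
    push_cast
    rw [← hq]
    linear_combination q * hroot
  have hk2 : ‖((((a₂ : ℚ) - 3) * ratPlusSymbol f 0 : ℚ) : ℚ_[2])‖ ≤ 2 := by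
    rw [hk]
    push_cast
    exact norm_intCast_div_two_le k
  have h := congrArg (‖·‖) hkey
  simp only [norm_mul, hα2, hαu, mul_one] at h
  rw [norm_mul, h]
  exact hk2

/-- **`‖μ_{f,α}(a + 2ᵐℤ₂)‖₂ ≤ 2` for every newform of ODD level with real coefficients and the root
`α` of `X² − a₂X + 2` with `‖α⁻¹‖ ≤ 1` — NO hypothesis on `E[2]`** (replaces the odd Eisenstein
multiple `n₀{∞,0} ∈ Λ_f` of `norm_msdMeasure_two_le_two`): `μ(ℤ₂) = α⁻¹(α − 1)[0]⁺` and
`μ(a + 2^{m+1}ℤ₂) = α^{−(m+1)}k₁/2 − α^{−(m+2)}k₂/2 + α^{−(m+2)}(α − 1)[0]⁺`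
(`exists_ratPlusSymbol_eq_add_div_two` at the cusps `a/2^{m+1}`, `a/2^m`, whose denominators are
prime to `N`), three terms of norm `≤ 2`. [cite: MazurTateTeitelbaum1986Invent, §I.10 (10.1)] -/
theorem norm_msdMeasure_two_le_two_auto {f : CuspForm (Gamma0 N) 2} (hf : IsNewform0 f)
    (hreal : ∀ n, (cuspCoeff f n).im = 0) (h2N : ¬ 2 ∣ N) {a₂ : ℤ} (ha₂ : cuspCoeff f 2 = a₂)
    {α : ℚ_[2]} (hα : ‖α⁻¹‖ ≤ 1) (hroot : α ^ 2 - a₂ * α + 2 = 0) :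
    ∀ (m : ℕ) (a : ZMod (2 ^ m)), ‖msdMeasure f α m a‖ ≤ 2 := by
  have hε := norm_sub_one_mul_ratPlusSymbol_zero_le_two hf hreal h2N ha₂ hα hroot
  have hαi : ∀ j : ℕ, ‖α⁻¹ ^ j‖ ≤ 1 := fun j ↦ by
    rw [norm_pow]; exact pow_le_one₀ (norm_nonneg _) hα
  have hsym : ∀ m k : ℕ, ∃ z : ℤ,
      ratPlusSymbol f ((m : ℚ) / (2 : ℚ) ^ k) = ratPlusSymbol f 0 + (z : ℚ) / 2 := fun m k ↦
    exists_ratPlusSymbol_eq_add_div_two f hreal (coprime_den_div_prime_pow (p := 2) h2N m k)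
  intro m a
  cases m with
  | zero =>
    simp only [msdMeasure]
    have h1 : (1 - α⁻¹) * ((ratPlusSymbol f 0 : ℚ) : ℚ_[2]) =
        α⁻¹ ^ 1 * ((α - 1) * ((ratPlusSymbol f 0 : ℚ) : ℚ_[2])) := by
      have hα0 : α ≠ 0 := by rintro rfl; norm_num at hroot
      field_simp
    rw [h1, norm_mul]
    calc _ ≤ 1 * 2 := mul_le_mul (hαi 1) hε (norm_nonneg _) zero_le_one
      _ = 2 := one_mul _
  | succ m =>
    obtain ⟨z₁, hz₁⟩ := hsym a.val (m + 1)
    obtain ⟨z₂, hz₂⟩ := hsym a.val m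
    simp only [msdMeasure]
    have hcast : ((2 : ℕ) : ℚ) = (2 : ℚ) := by norm_num
    rw [hcast, hz₁, hz₂]
    push_cast
    have hsplit : α⁻¹ ^ (m + 1) * (((ratPlusSymbol f 0 : ℚ) : ℚ_[2]) + (z₁ : ℚ_[2]) / 2) -
        α⁻¹ ^ (m + 2) * (((ratPlusSymbol f 0 : ℚ) : ℚ_[2]) + (z₂ : ℚ_[2]) / 2) =
        α⁻¹ ^ (m + 1) * ((z₁ : ℚ_[2]) / 2) + -(α⁻¹ ^ (m + 2) * ((z₂ : ℚ_[2]) / 2)) +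
          α⁻¹ ^ (m + 2) * ((α - 1) * ((ratPlusSymbol f 0 : ℚ) : ℚ_[2])) := by
      have hα0 : α ≠ 0 := by rintro rfl; norm_num at hroot
      have hαα : α⁻¹ ^ (m + 2) * α = α⁻¹ ^ (m + 1) := by
        rw [pow_succ, mul_assoc, inv_mul_cancel₀ hα0, mul_one]
      linear_combination (-((ratPlusSymbol f 0 : ℚ) : ℚ_[2])) * hαα
    rw [hsplit]
    have hA : ‖α⁻¹ ^ (m + 1) * ((z₁ : ℚ_[2]) / 2)‖ ≤ 2 := by
      rw [norm_mul]
      calc _ ≤ 1 * 2 := mul_le_mul (hαi _) (norm_intCast_div_two_le z₁) (norm_nonneg _) zero_le_one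
        _ = 2 := one_mul _
    have hB : ‖-(α⁻¹ ^ (m + 2) * ((z₂ : ℚ_[2]) / 2))‖ ≤ 2 := by
      rw [norm_neg, norm_mul]
      calc _ ≤ 1 * 2 := mul_le_mul (hαi _) (norm_intCast_div_two_le z₂) (norm_nonneg _) zero_le_one
        _ = 2 := one_mul _
    have hC : ‖α⁻¹ ^ (m + 2) * ((α - 1) * ((ratPlusSymbol f 0 : ℚ) : ℚ_[2]))‖ ≤ 2 := by
      rw [norm_mul]
      calc _ ≤ 1 * 2 := mul_le_mul (hαi _) hε (norm_nonneg _) zero_le_one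
        _ = 2 := one_mul _
    refine (Padic.nonarchimedean _ _).trans (max_le ?_ hC)
    exact (Padic.nonarchimedean _ _).trans (max_le hA hB)

/-! ### §4. Every coefficient of `L₂(f, α, T)` is `2`-integral -/

/-- **`‖[Tᵏ] L₂(f, α, T)‖₂ ≤ 1` for a newform of odd level, real coefficients, `α` the unit root —
granted the distribution relation of `μ_{f,α}` (`hdist`)**: by the doubling `padicLRiemannSum_two` each
Riemann sum is `2 ×` a sum of terms of norm `≤ 2` (`norm_msdMeasure_two_le_two_auto`), so of norm
`≤ 1`; the sums converge to the coefficient (`tendsto_padicLRiemannSum_of_norm_le`) and the unit ball is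
closed. [cite: MazurTateTeitelbaum1986Invent, §I.10–§I.13] -/
theorem norm_padicLCoeff_two_le_one_auto {f : CuspForm (Gamma0 N) 2} (hf : IsNewform0 f)
    (hreal : ∀ n, (cuspCoeff f n).im = 0) (h2N : ¬ 2 ∣ N) {a₂ : ℤ} (ha₂ : cuspCoeff f 2 = a₂)
    {α : ℚ_[2]} (hα : ‖α⁻¹‖ ≤ 1) (hroot : α ^ 2 - a₂ * α + 2 = 0)
    (hdist : ∀ (n : ℕ) (a : ZMod (2 ^ n)),
      ∑ b ∈ Finset.univ.filter (fun b : ZMod (2 ^ (n + 1)) ↦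
        ZMod.castHom (pow_dvd_pow 2 n.le_succ) (ZMod (2 ^ n)) b = a), msdMeasure f α (n + 1) b =
        msdMeasure f α n a)
    (k : ℕ) : ‖padicLCoeff f α k‖ ≤ 1 := by
  have hμ := norm_msdMeasure_two_le_two_auto hf hreal h2N ha₂ hα hroot
  have hRS : ∀ n, ‖padicLRiemannSum f α k n‖ ≤ 1 := by
    intro n
    rw [padicLRiemannSum_two]
    have hS : ‖∑ s : ZMod (2 ^ n),
        msdMeasure f α (n + 2) ((cyclotomicGenerator 2 : ZMod (2 ^ (n + 2))) ^ s.val) *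
          (s.val.choose k : ℚ_[2])‖ ≤ 2 := by
      refine IsUltrametricDist.norm_sum_le_of_forall_le_of_nonneg zero_le_two fun s _ ↦ ?_
      have hc : ‖((s.val.choose k : ℕ) : ℚ_[2])‖ ≤ 1 := by
        have h := Padic.norm_int_le_one (p := 2) ((s.val.choose k : ℕ) : ℤ)
        rwa [Int.cast_natCast] at h
      rw [norm_mul]
      calc _ ≤ 2 * 1 := mul_le_mul (hμ _ _) hc (norm_nonneg _) zero_le_two
        _ = 2 := mul_one _
    rw [norm_mul, norm_two_two]
    calc (2 : ℝ)⁻¹ * _ ≤ (2 : ℝ)⁻¹ * 2 := by gcongr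
      _ = 1 := by norm_num
  exact le_of_tendsto (tendsto_padicLRiemannSum_of_norm_le hdist ⟨2, hμ⟩ k).norm
    (Eventually.of_forall hRS)

end Measure

/-! ### §5. For an elliptic curve `E = W/ℚ` good ordinary at `2`: `L₂(E, T) ∈ ℤ₂⟦T⟧`, unconditionally -/

section Curve

variable {N : ℕ} [NeZero N] {f : CuspForm (Gamma0 N) 2}
  {W : WeierstrassCurve ℚ} [W.IsElliptic] [W.IsGloballyMinimal]

/-- **INT2-AUTO.** For `E = W/ℚ` globally minimal, good ORDINARY at `2`, and `f` its newform (any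
level `N`; then `2 ∤ N`): every coefficient of the `2`-adic `L`-function `L₂(f, α, T)` (`α` the unit
root, periods `Ω⁺_f`, `γ = 5`, `Δ = {±1}`) lies in `ℤ₂` — with NO hypothesis on `E[2]`, on the `2`-adic
image, or on the Manin constant (compare `padicLFunction_integral_two`, which assumed `E[2]`
irreducible). Inputs: `msdMeasure_distribution_of_isNewformOf`, `unitRoot_coe_spec`,
`cuspCoeff_eq_frobeniusTrace_of_isNewformOf_holds`, `not_dvd_level_of_isNewformOf`, and §1–§4.
[cite: MazurTateTeitelbaum1986Invent, §I.10–§I.13] -/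
theorem padicLFunction_integral_two_auto (hord : IsOrdinaryAt W 2) (hf : IsNewformOf W f) (k : ℕ) :
    ‖padicLCoeff f (unitRoot W 2 : ℚ_[2]) k‖ ≤ 1 := by
  obtain ⟨hαeq, hαu, -⟩ := unitRoot_coe_spec (W := W) hord
  have hpN : ¬ 2 ∣ N := not_dvd_level_of_isNewformOf hf hord.1
  have hap : cuspCoeff f 2 = ((W.frobeniusTrace 2 : ℤ) : ℂ) :=
    cuspCoeff_eq_frobeniusTrace_of_isNewformOf_holds hf hord.1
  have hα : ‖(unitRoot W 2 : ℚ_[2])⁻¹‖ ≤ 1 := by rw [norm_inv, hαu, inv_one]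
  exact norm_padicLCoeff_two_le_one_auto hf.1 (cuspCoeff_im_eq_zero_of_coeffField_eq_bot
    hf.coeffField_eq_bot) hpN hap hα hαeq (msdMeasure_distribution_of_isNewformOf hord hf) k

/-- Coefficient form: `‖[Tᵏ] L₂(f, α, T)‖₂ ≤ 1`. [cite: MazurTateTeitelbaum1986Invent, §I.12] -/
theorem norm_coeff_padicLFunction_two_le_one_auto (hord : IsOrdinaryAt W 2) (hf : IsNewformOf W f)
    (k : ℕ) : ‖PowerSeries.coeff k (padicLFunction f (unitRoot W 2 : ℚ_[2]))‖ ≤ 1 := by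
  rw [coeff_padicLFunction]
  exact padicLFunction_integral_two_auto hord hf k

/-- **`L₂(E, T) ∈ Λ = ℤ₂⟦T⟧` for EVERY curve good ordinary at `2`** (the lens-1 INT2-AUTO shape
`∃ L₀ : IwasawaAlgebra 2, ι L₀ = padicLFunction f α`): coefficientwise criterion
`exists_iwasawaToPowerSeries_eq_iff_norm_coeff_le_one`. In the residual cell's currency: the slot
`ν₂ := min {e : 2^e L₂ ∈ Λ}` is `0` on the whole good-ordinary-at-`2` locus in `f`-normalisation, so
the `hint` binder of `bsdp_two_of_prop514_of_lowerBound` reduces to the period comparison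
`Ω_W ∣₂ Ω⁺_f`. [cite: MazurTateTeitelbaum1986Invent, §I.12] -/
theorem exists_iwasawaToPowerSeries_eq_padicLFunction_two_auto (hord : IsOrdinaryAt W 2)
    (hf : IsNewformOf W f) :
    ∃ L₀ : IwasawaAlgebra 2,
      iwasawaToPowerSeries 2 L₀ = padicLFunction f (unitRoot W 2 : ℚ_[2]) :=
  (exists_iwasawaToPowerSeries_eq_iff_norm_coeff_le_one _).mpr fun k ↦
    norm_coeff_padicLFunction_two_le_one_auto hord hf k

/-- Uniqueness of the integral lift (`iwasawaToPowerSeries_injective`).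
[cite: MazurTateTeitelbaum1986Invent, §I.12] -/
theorem existsUnique_iwasawaToPowerSeries_eq_padicLFunction_two_auto (hord : IsOrdinaryAt W 2)
    (hf : IsNewformOf W f) :
    ∃! L₀ : IwasawaAlgebra 2,
      iwasawaToPowerSeries 2 L₀ = padicLFunction f (unitRoot W 2 : ℚ_[2]) := by
  obtain ⟨G, hG⟩ := exists_iwasawaToPowerSeries_eq_padicLFunction_two_auto hord hf
  exact ⟨G, hG, fun G' hG' ↦ iwasawaToPowerSeries_injective 2 (hG'.trans hG.symm)⟩

end Curve

end Literature.NumberTheory.EllipticCurves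

end
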